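import Mathlib
import Literature.Computability.AlgebraicComplexity.LR21TorusWeights
import Literature.Computability.AlgebraicComplexity.LR21Datum
import Literature.Computability.AlgebraicComplexity.LRPencilOfMatrix
import Summits.ValiantsHypothesis.ValiantsHypothesis.Theorems.RigidityForcesSymmetryPairTiedTorusBoundDefs

/-!
# Crux `RankRigidMinimalRepr` (stmt-ValiantsHypothesis-18034), line `PairTiedTorusBound`, stub `stub_levelDecomp` —
# step 3: WEIGHT BOOKKEEPING on supports, and typing by unique factorisation

Route `ValiantsHypothesis/RigidityForcesSymmetry`, registered line `Cruxes/RankRigidMinimalRepr/Lines/PairTiedTorusBound.lean`,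
dictionary stub `stub_levelDecomp` (helper 3).  Here `m + 1` = size of the permanent (so that column `0` exists).

* §1 (any scalar weights `wv v` of the variables).  A polynomial "carries `a` to `b`" when every monomial `x^δ` of its
  support has `(∏ v, wv v ^ δ v) · a = b` (predicate inlined, no new vocabulary).  Stable under products (arrows
  compose), sums, scalars, negation, and hence under powers / `vecMul` / `mulVec` of matrices whose `(r, s)` entry
  carries `θ s` to `θ r` — the weight-graded matrices of the spectral gauge (`…RankRigidMinimalReprSpectralGauge.lean`).
* §2 (the generic element of `tiedTorus (m+1) k`: row `i` scaled by the prime `primes₂ (inl i)`, untied column `j`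
  (`k < j`) by `primes₂ (inr j)`, tied columns `j ≤ k` by the one prime `primes₂ (inr 0)`).  The weight of `x^δ` is
  `∏_x primes₂ x ^ (E δ x)` with `E δ` = (row degrees; untied column degrees; tied TOTAL at column `0`)
  (`prod_weight_eq_prod_primes_pow`), so by unique factorisation (`LRPencil.eq_of_prod_prime_pow_eq_fintype`) the
  weight determines `E δ`.  `typed_of_weights`: if all pairs `x^δ ∈ supp P`, `x^δ' ∈ supp Q` have weight product the
  character `∏_i p_i · ∏_j q_{tc j}`, then `P`, `Q` are `IsTiedTyped` (tree copy `…PairTiedTorusBoundDefs`, p535634) by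
  complementary data, the row set of `P` having the size of the degree of `P`.

HONEST FRAMING: helper toward ONE registered stub of a forward rung inside one route; nothing here bears on the
crux `RankRigidMinimalRepr` itself or on `VP ≠ VNP`.
-/
set_option autoImplicit false

-- the mandated summit-side namespace repeats a component by design (single-problem summit)
set_option linter.dupNamespace false

noncomputable section

open MvPolynomial Finset
open Literature.Computability.AlgebraicComplexity LRPencil
open Summit.ValiantsHypothesis.ValiantsHypothesis.Theorems.RigidityForcesSymmetryPairTiedTorusBound

namespace Summit.ValiantsHypothesis.ValiantsHypothesis.Theorems.RigidityForcesSymmetryRankRigidMinimalRepr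

namespace WeightTyping

/-! ### §1 Weight bookkeeping on supports -/

section Bookkeeping

variable {K : Type*} [CommRing K] {σ : Type*} [Fintype σ] (wv : σ → K)

/-- Weights of monomials are multiplicative. -/
theorem prod_pow_add (δ₁ δ₂ : σ →₀ ℕ) :
    (∏ v, wv v ^ (δ₁ + δ₂) v) = (∏ v, wv v ^ δ₁ v) * ∏ v, wv v ^ δ₂ v := by
  rw [← Finset.prod_mul_distrib]
  exact Finset.prod_congr rfl fun v _ => by rw [Finsupp.add_apply, pow_add]

/-- The trivial monomial has weight `1`. -/
theorem prod_pow_zero : (∏ v, wv v ^ (0 : σ →₀ ℕ) v) = 1 := by simp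

/-- A single variable `x_v` has weight `wv v`. -/
theorem prod_pow_single [DecidableEq σ] (u : σ) : (∏ v, wv v ^ (Finsupp.single u 1) v) = wv u := by
  rw [Finset.prod_eq_single u]
  · rw [Finsupp.single_eq_same, pow_one]
  · intro v _ hv; rw [Finsupp.single_eq_of_ne hv, pow_zero]
  · intro h; exact absurd (Finset.mem_univ u) h

/-- Products compose arrows: if `p` carries `a` to `b` and `q` carries `b` to `c`, then `p * q` (and `q * p`)
carries `a` to `c`. -/
theorem carries_mul {p q : MvPolynomial σ K} {a b c : K}
    (hp : ∀ δ ∈ p.support, (∏ v, wv v ^ δ v) * a = b) (hq : ∀ δ ∈ q.support, (∏ v, wv v ^ δ v) * b = c) :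
    ∀ δ ∈ (p * q).support, (∏ v, wv v ^ δ v) * a = c := by
  classical
  intro δ hδ
  obtain ⟨δ₁, h₁, δ₂, h₂, rfl⟩ := Finset.mem_add.1 (MvPolynomial.support_mul p q hδ)
  rw [prod_pow_add, mul_comm (∏ v, wv v ^ δ₁ v), mul_assoc, hp δ₁ h₁, hq δ₂ h₂]

/-- Symmetric form of `carries_mul`. -/
theorem carries_mul' {p q : MvPolynomial σ K} {a b c : K}
    (hq : ∀ δ ∈ q.support, (∏ v, wv v ^ δ v) * a = b) (hp : ∀ δ ∈ p.support, (∏ v, wv v ^ δ v) * b = c) :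
    ∀ δ ∈ (p * q).support, (∏ v, wv v ^ δ v) * a = c := by
  rw [mul_comm]; exact carries_mul wv hq hp

/-- Sums preserve arrows. -/
theorem carries_sum {ι : Type*} (s : Finset ι) {f : ι → MvPolynomial σ K} {a b : K}
    (hf : ∀ i ∈ s, ∀ δ ∈ (f i).support, (∏ v, wv v ^ δ v) * a = b) :
    ∀ δ ∈ (∑ i ∈ s, f i).support, (∏ v, wv v ^ δ v) * a = b := by
  classical
  intro δ hδ
  obtain ⟨i, hi, hδi⟩ := Finset.mem_biUnion.1 (MvPolynomial.support_sum hδ)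
  exact hf i hi δ hδi

/-- Constant multiples preserve arrows. -/
theorem carries_C_mul {p : MvPolynomial σ K} {a b : K} (κ : K)
    (hp : ∀ δ ∈ p.support, (∏ v, wv v ^ δ v) * a = b) :
    ∀ δ ∈ (C κ * p).support, (∏ v, wv v ^ δ v) * a = b := by
  classical
  intro δ hδ
  rw [MvPolynomial.C_mul'] at hδ
  exact hp δ (MvPolynomial.support_smul hδ)

/-- Negation preserves arrows. -/
theorem carries_neg {p : MvPolynomial σ K} {a b : K}
    (hp : ∀ δ ∈ p.support, (∏ v, wv v ^ δ v) * a = b) :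
    ∀ δ ∈ (-p).support, (∏ v, wv v ^ δ v) * a = b := by
  intro δ hδ
  rw [MvPolynomial.support_neg] at hδ
  exact hp δ hδ

/-- `1` carries `a` to `a`. -/
theorem carries_one (a : K) : ∀ δ ∈ (1 : MvPolynomial σ K).support, (∏ v, wv v ^ δ v) * a = a := by
  classical
  intro δ hδ
  have h : δ ∈ ({0} : Finset (σ →₀ ℕ)) := by
    rw [← C_1, C_apply] at hδ
    exact MvPolynomial.support_monomial_subset hδ
  rw [Finset.mem_singleton] at h
  rw [h, prod_pow_zero, one_mul]

variable {ι : Type*} [Fintype ι]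

/-- **Powers of a weight-graded matrix are weight-graded**: if every entry `D r s` carries `θ s` to `θ r`, so does
every entry of `D ^ i`. -/
theorem carries_pow_apply [DecidableEq ι] {D : Matrix ι ι (MvPolynomial σ K)} {θ : ι → K}
    (hD : ∀ r s, ∀ δ ∈ (D r s).support, (∏ v, wv v ^ δ v) * θ s = θ r) :
    ∀ (i : ℕ) (r s : ι), ∀ δ ∈ ((D ^ i) r s).support, (∏ v, wv v ^ δ v) * θ s = θ r := by
  intro i
  induction i with
  | zero =>
    intro r s δ hδ
    rw [pow_zero, Matrix.one_apply] at hδ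
    by_cases hrs : r = s
    · rw [if_pos hrs] at hδ
      rw [hrs]; exact carries_one wv (θ s) δ hδ
    · rw [if_neg hrs, MvPolynomial.support_zero] at hδ
      exact absurd hδ (Finset.notMem_empty δ)
  | succ i ih =>
    intro r s
    rw [pow_succ, Matrix.mul_apply]
    exact carries_sum wv _ fun t _ => carries_mul' wv (hD t s) (ih r t)

/-- `vecMul` by a weight-graded matrix: if `b s` carries `θ s` to `β` and `X r s` carries `θ s` to `θ r`, then
`(b ᵥ* X) s` carries `θ s` to `β`. -/
theorem carries_vecMul {X : Matrix ι ι (MvPolynomial σ K)} {θ : ι → K} {β : K} {b : ι → MvPolynomial σ K}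
    (hb : ∀ s, ∀ δ ∈ (b s).support, (∏ v, wv v ^ δ v) * θ s = β)
    (hX : ∀ r s, ∀ δ ∈ (X r s).support, (∏ v, wv v ^ δ v) * θ s = θ r) (s : ι) :
    ∀ δ ∈ ((Matrix.vecMul b X) s).support, (∏ v, wv v ^ δ v) * θ s = β := by
  rw [Matrix.vecMul, dotProduct]
  exact carries_sum wv _ fun t _ => carries_mul' wv (hX t s) (hb t)

/-- `mulVec` by a weight-graded matrix: if `c r` carries `γ` to `θ r` and `X r s` carries `θ s` to `θ r`, then
`(X *ᵥ c) r` carries `γ` to `θ r`. -/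
theorem carries_mulVec {X : Matrix ι ι (MvPolynomial σ K)} {θ : ι → K} {γ : K} {c : ι → MvPolynomial σ K}
    (hc : ∀ r, ∀ δ ∈ (c r).support, (∏ v, wv v ^ δ v) * γ = θ r)
    (hX : ∀ r s, ∀ δ ∈ (X r s).support, (∏ v, wv v ^ δ v) * θ s = θ r) (r : ι) :
    ∀ δ ∈ ((Matrix.mulVec X c) r).support, (∏ v, wv v ^ δ v) * γ = θ r := by
  rw [Matrix.mulVec, dotProduct]
  exact carries_sum wv _ fun t _ => carries_mul' wv (hc t) (hX r t)

/-- **Entries read off coefficient matrices.**  If the degree-one part of an affine polynomial `p` only involves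
variables `x_v` with `wv v * a = b` (a support condition on the coefficients of the `x_v`), then `hc₁ p` carries
`a` to `b`. -/
theorem carries_homogeneousComponent_one [DecidableEq σ] {p : MvPolynomial σ K} {a b : K}
    (h : ∀ u : σ, coeff (Finsupp.single u 1) p ≠ 0 → wv u * a = b) :
    ∀ δ ∈ (homogeneousComponent 1 p).support, (∏ v, wv v ^ δ v) * a = b := by
  intro δ hδ
  rw [MvPolynomial.mem_support_iff, coeff_homogeneousComponent] at hδ
  split_ifs at hδ with hdeg
  · have h0 : δ ≠ 0 := by
      rintro rfl; simp at hdeg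
    have hle : (δ.sum fun _ e => e) ≤ 1 := by
      have : (δ.sum fun _ e => e) = δ.degree := by simp [Finsupp.sum, Finsupp.degree]
      rw [this]; exact hdeg.le
    obtain ⟨u, rfl⟩ := exists_single_of_sum_le_one h0 hle
    rw [prod_pow_single]
    exact h u hδ
  · exact absurd rfl hδ

end Bookkeeping

/-! ### §2 The tied-torus weights: unique factorisation and typing -/

section Typing

variable {m : ℕ} (k : ℕ)

/-- The exponent bookkeeping of a monomial `x^δ` under the tie `k`: row degrees (`inl i`), untied column degrees
(`inr j`, `k < j`), and the tied TOTAL stored at column `0` (`inr 0`); the other tied columns store `0`. -/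
theorem prod_weight_eq_prod_primes_pow (δ : (Fin (m + 1) × Fin (m + 1)) →₀ ℕ) :
    (∏ v : Fin (m + 1) × Fin (m + 1),
        (primes₂ (m + 1) (Sum.inl v.1) *
          primes₂ (m + 1) (Sum.inr (if v.2.val ≤ k then 0 else v.2))) ^ δ v) =
      ∏ x : Fin (m + 1) ⊕ Fin (m + 1), primes₂ (m + 1) x ^
        (Sum.elim (fun i => ∑ j, δ (i, j))
          (fun j => if j.val ≤ k then (if j = 0 then ∑ j' ∈ univ.filter (fun j' : Fin (m + 1) => j'.val ≤ k),
            ∑ i, δ (i, j') else 0) else ∑ i, δ (i, j)) x) := by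
  set r := primes₂ (m + 1) with hr
  set T : Finset (Fin (m + 1)) := univ.filter (fun j' : Fin (m + 1) => j'.val ≤ k) with hT
  have h0T : (0 : Fin (m + 1)) ∈ T := by rw [hT, mem_filter]; exact ⟨mem_univ _, Nat.zero_le _⟩
  -- split the variable weights into row and column parts
  rw [Fintype.prod_sum_type]
  simp only [Sum.elim_inl, Sum.elim_inr, mul_pow, Finset.prod_mul_distrib]
  congr 1
  · -- rows
    rw [Fintype.prod_prod_type]
    exact Finset.prod_congr rfl fun i _ => Finset.prod_pow_eq_pow_sum univ (fun j => δ (i, j)) (r (Sum.inl i))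
  · -- columns
    have hcol : (∏ v : Fin (m + 1) × Fin (m + 1), r (Sum.inr (if v.2.val ≤ k then 0 else v.2)) ^ δ v) =
        ∏ j, r (Sum.inr (if j.val ≤ k then 0 else j)) ^ (∑ i, δ (i, j)) := by
      rw [Fintype.prod_prod_type_right]
      exact Finset.prod_congr rfl fun j _ =>
        Finset.prod_pow_eq_pow_sum univ (fun i => δ (i, j)) (r (Sum.inr (if j.val ≤ k then 0 else j)))
    rw [hcol]
    -- split both sides over tied / untied columns
    rw [← Finset.prod_filter_mul_prod_filter_not univ (fun j : Fin (m + 1) => j.val ≤ k),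
      ← Finset.prod_filter_mul_prod_filter_not univ (fun j : Fin (m + 1) => j.val ≤ k)
        (f := fun j => r (Sum.inr j) ^ _)]
    rw [← hT]
    congr 1
    · -- tied columns: all carry the prime of column `0`
      have h1 : ∏ j ∈ T, r (Sum.inr (if j.val ≤ k then 0 else j)) ^ (∑ i, δ (i, j)) =
          ∏ j ∈ T, r (Sum.inr 0) ^ (∑ i, δ (i, j)) :=
        Finset.prod_congr rfl fun j hj => by rw [if_pos (mem_filter.1 hj).2]
      have h2 : ∏ j ∈ T, r (Sum.inr j) ^
          (if j.val ≤ k then (if j = 0 then ∑ j' ∈ T, ∑ i, δ (i, j') else 0) else ∑ i, δ (i, j)) =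
          ∏ j ∈ T, (if j = 0 then r (Sum.inr 0) ^ (∑ j' ∈ T, ∑ i, δ (i, j')) else 1) :=
        Finset.prod_congr rfl fun j hj => by
          rw [if_pos (mem_filter.1 hj).2]
          split_ifs with hj0
          · rw [hj0]
          · rw [pow_zero]
      rw [h1, h2, Finset.prod_pow_eq_pow_sum, Finset.prod_ite_eq' T 0, if_pos h0T]
    · -- untied columns
      refine Finset.prod_congr rfl fun j hj => ?_
      have hj' : ¬ j.val ≤ k := (mem_filter.1 hj).2
      rw [if_neg hj', if_neg hj']

/-- The character `∏_i p_i · ∏_j q_{tc j}` of the generic tied-torus element is `∏_x primes₂ x ^ E_top x` with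
`E_top` = (all rows once; untied columns once; tied total `#tied` at column `0`). -/
theorem character_eq_prod_primes_pow :
    ((∏ i : Fin (m + 1), primes₂ (m + 1) (Sum.inl i)) *
        ∏ j : Fin (m + 1), primes₂ (m + 1) (Sum.inr (if j.val ≤ k then 0 else j))) =
      ∏ x : Fin (m + 1) ⊕ Fin (m + 1), primes₂ (m + 1) x ^
        (Sum.elim (fun _ => 1)
          (fun j => if j.val ≤ k then (if j = 0 then (univ.filter (fun j' : Fin (m + 1) => j'.val ≤ k)).card
            else 0) else 1) x) := by
  set r := primes₂ (m + 1) with hr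
  set T : Finset (Fin (m + 1)) := univ.filter (fun j' : Fin (m + 1) => j'.val ≤ k) with hT
  have h0T : (0 : Fin (m + 1)) ∈ T := by rw [hT, mem_filter]; exact ⟨mem_univ _, Nat.zero_le _⟩
  rw [Fintype.prod_sum_type]
  simp only [Sum.elim_inl, Sum.elim_inr, pow_one]
  congr 1
  rw [← Finset.prod_filter_mul_prod_filter_not univ (fun j : Fin (m + 1) => j.val ≤ k),
    ← Finset.prod_filter_mul_prod_filter_not univ (fun j : Fin (m + 1) => j.val ≤ k)
      (f := fun j => r (Sum.inr j) ^ _)]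
  rw [← hT]
  congr 1
  · have h1 : ∏ j ∈ T, r (Sum.inr (if j.val ≤ k then 0 else j)) = ∏ j ∈ T, r (Sum.inr 0) :=
      Finset.prod_congr rfl fun j hj => by rw [if_pos (mem_filter.1 hj).2]
    have h2 : ∏ j ∈ T, r (Sum.inr j) ^ (if j.val ≤ k then (if j = 0 then T.card else 0) else 1) =
        ∏ j ∈ T, (if j = 0 then r (Sum.inr 0) ^ T.card else 1) :=
      Finset.prod_congr rfl fun j hj => by
        rw [if_pos (mem_filter.1 hj).2]
        split_ifs with hj0
        · rw [hj0]
        · rw [pow_zero]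
    rw [h1, h2, Finset.prod_const, Finset.prod_ite_eq' T 0, if_pos h0T]
  · refine Finset.prod_congr rfl fun j hj => ?_
    have hj' : ¬ j.val ≤ k := (mem_filter.1 hj).2
    rw [if_neg hj', if_neg hj', pow_one]

/-- **Typing by unique factorisation.**  Let `P, Q` be polynomials in the `x_{ij}` (`i, j ∈ [m+1]`) such that every
pair of monomials `x^δ ∈ supp P`, `x^δ' ∈ supp Q` has tied-torus weight product equal to the character
(`weight δ · weight δ' = ∏_i p_i ∏_j q_{tc j}`), both non-zero, all monomials of `P` of degree `s`.  Then `P` is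
typed (`IsTiedTyped`, tree copy of the workfile's) by an `s`-set of rows `I`, an untied column profile `c` and a tied
total `ct`, and `Q` by the complementary data `Iᶜ, c', ct'` with `c + c' = 1` on untied columns and
`ct + ct' = #tied`. -/
theorem typed_of_weights {P Q : MvPolynomial (Fin (m + 1) × Fin (m + 1)) ℂ}
    (hPQ : ∀ δ ∈ P.support, ∀ δ' ∈ Q.support,
      (∏ v : Fin (m + 1) × Fin (m + 1),
          (primes₂ (m + 1) (Sum.inl v.1) * primes₂ (m + 1) (Sum.inr (if v.2.val ≤ k then 0 else v.2))) ^ δ v) *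
        (∏ v : Fin (m + 1) × Fin (m + 1),
          (primes₂ (m + 1) (Sum.inl v.1) * primes₂ (m + 1) (Sum.inr (if v.2.val ≤ k then 0 else v.2))) ^ δ' v) =
      (∏ i : Fin (m + 1), primes₂ (m + 1) (Sum.inl i)) *
        ∏ j : Fin (m + 1), primes₂ (m + 1) (Sum.inr (if j.val ≤ k then 0 else j)))
    (hP : P ≠ 0) (hQ : Q ≠ 0) {s : ℕ} (hdeg : ∀ δ ∈ P.support, (∑ v, δ v) = s) :
    ∃ (I : Finset (Fin (m + 1))) (c c' : Fin (m + 1) → ℕ) (ct ct' : ℕ), I.card = s ∧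
      IsTiedTyped (m + 1) k I c ct P ∧ IsTiedTyped (m + 1) k Iᶜ c' ct' Q ∧
      (∀ j : Fin (m + 1), k < j.val → c j + c' j = 1) ∧
      ct + ct' = (univ.filter fun j : Fin (m + 1) => j.val ≤ k).card := by
  classical
  set T : Finset (Fin (m + 1)) := univ.filter (fun j' : Fin (m + 1) => j'.val ≤ k) with hT
  -- the exponent bookkeeping `E δ` and `E_top`
  set E : ((Fin (m + 1) × Fin (m + 1)) →₀ ℕ) → (Fin (m + 1) ⊕ Fin (m + 1) → ℕ) := fun δ =>
    Sum.elim (fun i => ∑ j, δ (i, j))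
      (fun j => if j.val ≤ k then (if j = 0 then ∑ j' ∈ T, ∑ i, δ (i, j') else 0) else ∑ i, δ (i, j)) with hE
  set Etop : Fin (m + 1) ⊕ Fin (m + 1) → ℕ :=
    Sum.elim (fun _ => 1) (fun j => if j.val ≤ k then (if j = 0 then T.card else 0) else 1) with hEtop
  -- unique factorisation: `E δ + E δ' = E_top` for every pair
  have key : ∀ δ ∈ P.support, ∀ δ' ∈ Q.support, E δ + E δ' = Etop := by
    intro δ hδ δ' hδ'
    have h := hPQ δ hδ δ' hδ'
    rw [prod_weight_eq_prod_primes_pow k δ, prod_weight_eq_prod_primes_pow k δ',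
      character_eq_prod_primes_pow k, ← Finset.prod_mul_distrib] at h
    have h' : ∏ x, primes₂ (m + 1) x ^ (E δ + E δ') x = ∏ x, primes₂ (m + 1) x ^ Etop x := by
      rw [← h]
      exact Finset.prod_congr rfl fun x _ => by rw [Pi.add_apply, pow_add]
    exact eq_of_prod_prime_pow_eq_fintype (primes₂_prime (m + 1)) (primes₂_injective (m + 1)) h'
  obtain ⟨δ₀, hδ₀⟩ : ∃ δ₀, δ₀ ∈ P.support := by
    obtain ⟨d, hd⟩ := MvPolynomial.ne_zero_iff.1 hP; exact ⟨d, MvPolynomial.mem_support_iff.2 hd⟩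
  obtain ⟨δ₀', hδ₀'⟩ : ∃ δ₀', δ₀' ∈ Q.support := by
    obtain ⟨d, hd⟩ := MvPolynomial.ne_zero_iff.1 hQ; exact ⟨d, MvPolynomial.mem_support_iff.2 hd⟩
  have h00 := key δ₀ hδ₀ δ₀' hδ₀'
  -- every monomial of `P` has the bookkeeping of `δ₀`, every monomial of `Q` that of `δ₀'`
  have hEP : ∀ δ ∈ P.support, E δ = E δ₀ := fun δ hδ =>
    add_right_cancel ((key δ hδ δ₀' hδ₀').trans h00.symm)
  have hEQ : ∀ δ' ∈ Q.support, E δ' = E δ₀' := fun δ' hδ' =>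
    add_left_cancel ((key δ₀ hδ₀ δ' hδ').trans h00.symm)
  -- pointwise consequences of `E δ₀ + E δ₀' = E_top`
  have hrow : ∀ i : Fin (m + 1), E δ₀ (Sum.inl i) + E δ₀' (Sum.inl i) = 1 := fun i => by
    have := congrFun h00 (Sum.inl i); simpa [hEtop] using this
  have hcolU : ∀ j : Fin (m + 1), k < j.val → E δ₀ (Sum.inr j) + E δ₀' (Sum.inr j) = 1 := fun j hj => by
    have := congrFun h00 (Sum.inr j)
    simp only [Pi.add_apply, hEtop, Sum.elim_inr, if_neg (not_le.2 hj)] at this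
    exact this
  have hcolT : E δ₀ (Sum.inr 0) + E δ₀' (Sum.inr 0) = T.card := by
    have := congrFun h00 (Sum.inr 0)
    simp only [Pi.add_apply, hEtop, Sum.elim_inr, Fin.val_zero, Nat.zero_le, if_true] at this
    exact this
  -- the data
  refine ⟨univ.filter (fun i => E δ₀ (Sum.inl i) = 1), fun j => E δ₀ (Sum.inr j), fun j => E δ₀' (Sum.inr j),
    E δ₀ (Sum.inr 0), E δ₀' (Sum.inr 0), ?_, ?_, ?_, fun j hj => hcolU j hj, hcolT⟩
  · -- `|I| = s`: the row degrees of `δ₀` are `0/1` and sum to the degree `s`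
    have h1 : (univ.filter (fun i => E δ₀ (Sum.inl i) = 1)).card = ∑ i, E δ₀ (Sum.inl i) := by
      rw [Finset.card_filter]
      refine Finset.sum_congr rfl fun i _ => ?_
      have := hrow i
      split_ifs with h
      · exact h.symm
      · omega
    rw [h1, ← hdeg δ₀ hδ₀, Fintype.sum_prod_type]
    rfl
  · -- `P` is typed
    intro δ hδ
    have hEδ := hEP δ hδ
    have hErow : ∀ i, E δ (Sum.inl i) = ∑ j, δ (i, j) := fun i => rfl
    have hEcol : ∀ j : Fin (m + 1), k < j.val → E δ (Sum.inr j) = ∑ i, δ (i, j) := fun j hj => by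
      show (if j.val ≤ k then _ else _) = _
      rw [if_neg (not_le.2 hj)]
    have hEtied : E δ (Sum.inr 0) = ∑ j' ∈ T, ∑ i, δ (i, j') := by
      simp [hE]
    refine ⟨fun i => ?_, fun j hj => ?_, ?_⟩
    · rw [← hErow, hEδ]
      simp only [mem_filter, mem_univ, true_and]
      have := hrow i
      split_ifs with h
      · exact h
      · omega
    · show _ = E δ₀ (Sum.inr j)
      rw [← hEcol j hj, hEδ]
    · show _ = E δ₀ (Sum.inr 0)
      rw [← hEδ, hEtied]
  · -- `Q` is typed by the complementary data
    intro δ' hδ'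
    have hEδ := hEQ δ' hδ'
    have hErow : ∀ i, E δ' (Sum.inl i) = ∑ j, δ' (i, j) := fun i => rfl
    have hEcol : ∀ j : Fin (m + 1), k < j.val → E δ' (Sum.inr j) = ∑ i, δ' (i, j) := fun j hj => by
      show (if j.val ≤ k then _ else _) = _
      rw [if_neg (not_le.2 hj)]
    have hEtied : E δ' (Sum.inr 0) = ∑ j' ∈ T, ∑ i, δ' (i, j') := by
      simp [hE]
    refine ⟨fun i => ?_, fun j hj => ?_, ?_⟩
    · rw [← hErow, hEδ]
      simp only [mem_compl, mem_filter, mem_univ, true_and]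
      have := hrow i
      split_ifs with h
      · omega
      · omega
    · show _ = E δ₀' (Sum.inr j)
      rw [← hEcol j hj, hEδ]
    · show _ = E δ₀' (Sum.inr 0)
      rw [← hEδ, hEtied]

end Typing

end WeightTyping

end Summit.ValiantsHypothesis.ValiantsHypothesis.Theorems.RigidityForcesSymmetryRankRigidMinimalRepr

end
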